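import Mathlib
import HarnessLib
import HarnessLib.Audit
import Summits.QuantumAdvantage.QuantumAdvantage.Theses.ExactnessDial
import Summits.QuantumAdvantage.QuantumAdvantage.Theorems.MultiRingBridge
import Summits.QuantumAdvantage.QuantumAdvantage.Theorems.ExactnessDialOddToAll
import Summits.QuantumAdvantage.AdviceFreeQNC0.WalkCoordinates
import Summits.QuantumAdvantage.AdviceFreeQNC0.DWalkOneBell
import Summits.QuantumAdvantage.AdviceFreeQNC0.WalkTubeRank
import Literature.Computability.MetaComplexity.SmolenskyCorrelation
import Literature.Computability.MetaComplexity.SmolenskyParity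
import Literature.Computability.MetaComplexity.LowDegreeComposition

/-!
# HolonomyDial — Strategy (cell decomp-qadv, seat lens-2, generation 13; supports item 26531 `ExactnessDial.PolyLossOddU3`)

§0–§2a of the node: objects (`Wtot`, `hol`, `gCond`, `BinPtrWin`), pieces (`BinPointerLoss3`, `PointerLift3`, `HolDecodeLoss3`, exact-grade asides) and the steered one-stake strategy `ptrStrat` with its relation law `rel_ptrStrat_iff`.

Split (≤ 400 lines) of the node file `HOME/decomp-qadv-lens-2/g13/HolonomyDial.lean` (sha256 b710fc34…, farm rc 0, no
placeholders); declarations verbatim, namespace `Summit.QuantumAdvantage.QuantumAdvantage.Theorems.HolonomyDial`.  Record: NODE-g13.md.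
-/

set_option linter.dupNamespace false

noncomputable section
open scoped Classical

namespace Summit.QuantumAdvantage.QuantumAdvantage.Theorems

open Finset
open Literature.Computability.QuantumComplexity Literature.Computability.QuantumComplexity.RingHLF
open Literature.Computability.MetaComplexity Literature.Computability.MetaComplexity.Smolensky
open Summit.QuantumAdvantage.AdviceFreeQNC0
open Summit.QuantumAdvantage.QuantumAdvantage.Theses (ExactnessDial.PolyLossOddU3 ExactnessDial.NoPerfectOdd3
  ExactnessDial.NoPerfectConst3 ExactnessDial.MassStep3u ExactnessDial.OddToAll3 ExactnessDial.DPLift3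
  ExactnessDial.MultiRingBridge3 ExactnessDial.closes)

namespace HolonomyDial

/-! ## §0 Objects: the holonomy trit, the root kernel bits, the {0,1}-pointer -/

/-- total walk weight `W(x) = W_{N-1}(x) = #{i < N-1 : u_i(x) = 1}` (tree `Wk`). -/
def Wtot {N : ℕ} (x : Fin N → Bool) : ℕ := Wk x (N - 1)

/-- **the holonomy trit** `hol(x) = (N + W(x)) mod 3` — by `suppWalkLaw` it decides the kernel bit at the root:
`v⋆_0(x) = [hol x ≠ 2]`, and together with `x_0` also `v⋆_1`. -/
def hol {N : ℕ} (x : Fin N → Bool) : ℕ := (N + Wtot x) % 3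

/-- the kernel-support condition at position `k` in walk coordinates (verbatim from `traceForm`):
`g_k(x) = [k + N + W_k + W ≢ 2 (mod 3)]`. -/
def gCond {N : ℕ} (x : Fin N → Bool) (k : ℕ) : Prop := (k + N + Wk x k + Wk x (N - 1)) % 3 ≠ 2

/-- **the {0,1}-pointer steered by `f` wins at `x`**: it deviates from the canonical guess at position `0` when
`f x = 1` and at position `1` otherwise, and wins iff the kernel bit there is `1`. -/
def BinPtrWin {N : ℕ} (f : CubeFn (ZMod 3) N) (x : Fin N → Bool) : Prop :=
  (f x = 1 → gCond x 0) ∧ (f x ≠ 1 → gCond x 1)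

/-! ## §1 Pieces -/

/-- piece `BinPointerLoss3` [crux · NECESSARY · WEAKER-GENUINE · OPEN · INSTRUMENTABLE · ATTACKABLE]:
at every polylog degree, every {0,1}-pointer loses an inverse-polynomial fraction of the odd class (one exponent);
equivalently no polylog-degree `𝔽₃` polynomial SEPARATES the two critical holonomy levels
`{hol = 2}` / `{hol ≡ x_0 (given x_0)}` up to `n^{-C}`. -/
def BinPointerLoss3 : Prop :=
  ∃ C : ℕ, ∀ c : ℕ, ∃ n₀ : ℕ, ∀ n ≥ n₀, ∀ f : CubeFn (ZMod 3) n,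
    f ∈ lowDeg (ZMod 3) n ((Nat.log 2 n) ^ c) →
      ((univ.filter fun x : Fin n → Bool => OddZeros x ∧ BinPtrWin f x).card : ℝ) ≤
        (1 - 1 / (n : ℝ) ^ C) * (2 : ℝ) ^ (n - 1)

/-- piece `PointerLift3` [DECLARED RESIDUAL ≡ T mod `BinPointerLoss3` · UNDECIDED · IDEA-NEEDED]:
«winning ⟹ separating» — hardness of the two-position pointer class lifts to all polylog strategies. -/
def PointerLift3 : Prop := BinPointerLoss3 → ExactnessDial.PolyLossOddU3

/-- rung `HolDecodeLoss3` [NECESSARY for `BinPointerLoss3` · PROVED OUTRIGHT in §K]: no polylog-degree `𝔽₃`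
polynomial computes the holonomy trit on more than a `(1 - n^{-C})` fraction of the odd class. -/
def HolDecodeLoss3 : Prop :=
  ∃ C : ℕ, ∀ c : ℕ, ∃ n₀ : ℕ, ∀ n ≥ n₀, ∀ V : CubeFn (ZMod 3) n,
    V ∈ lowDeg (ZMod 3) n ((Nat.log 2 n) ^ c) →
      ((univ.filter fun x : Fin n → Bool => OddZeros x ∧ V x = ((hol x : ℕ) : ZMod 3)).card : ℝ) ≤
        (1 - 1 / (n : ℝ) ^ C) * (2 : ℝ) ^ (n - 1)

/-- aside `BinPointerPerfect3` (exact grade, constant degree; NECESSARY for 27380 `NoPerfectConst3`,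
`binPointerPerfect3_of_noPerfectConst3`; INSTRUMENT `d_sep(N)`): no constant-degree {0,1}-pointer is perfect on
the odd class for large `n`. -/
def BinPointerPerfect3 : Prop :=
  ∀ d : ℕ, ∃ n₀ : ℕ, ∀ n ≥ n₀, ∀ f : CubeFn (ZMod 3) n, f ∈ lowDeg (ZMod 3) n d →
    ∃ x : Fin n → Bool, OddZeros x ∧ ¬ BinPtrWin f x

/-- aside `HolDecodePerfect3` (exact grade; PROVED, `holDecodePerfect3`): no constant-degree polynomial decodes
the holonomy trit on the whole odd class for large `n`. -/
def HolDecodePerfect3 : Prop :=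
  ∀ d : ℕ, ∃ n₀ : ℕ, ∀ n ≥ n₀, ∀ V : CubeFn (ZMod 3) n, V ∈ lowDeg (ZMod 3) n d →
    ∃ x : Fin n → Bool, OddZeros x ∧ V x ≠ ((hol x : ℕ) : ZMod 3)

/-! ## §2 Laws -/

section Strategy

variable {N : ℕ}

/-- `0/1`-indicator of the canonical guess `t_j(x) = x_j ⊕ x_{j+1}` as an `𝔽₃`-polynomial:
`[a ⊕ b] = a + b + ab (mod 3)`. -/
def tPoly (j : Fin N) : CubeFn (ZMod 3) N :=
  mono (ZMod 3) {j} + mono (ZMod 3) {nxt j} + mono (ZMod 3) {j} * mono (ZMod 3) {nxt j}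

/-- Ring-game helper `tPoly_mem` (lens-2 law package; see the module docstring). -/
theorem tPoly_mem (j : Fin N) : tPoly j ∈ lowDeg (ZMod 3) N 2 := by
  unfold tPoly
  refine Submodule.add_mem _ (Submodule.add_mem _ ?_ ?_) ?_
  · exact mono_mem_lowDeg (D := 2) (by simp)
  · exact mono_mem_lowDeg (D := 2) (by simp)
  · exact mul_mem_lowDeg_add (D := 1) (D' := 1) (mono_mem_lowDeg (by simp)) (mono_mem_lowDeg (by simp))

/-- Ring-game helper `mono_singleton_apply` (lens-2 law package; see the module docstring). -/
theorem mono_singleton_apply (j : Fin N) (x : Fin N → Bool) :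
    mono (ZMod 3) {j} x = if x j then 1 else 0 := by
  rw [mono_apply]; simp

/-- Ring-game helper `xor_indicator_bool` (lens-2 law package; see the module docstring). -/
theorem xor_indicator_bool (a b : Bool) :
    ((if a then (1 : ZMod 3) else 0) + (if b then 1 else 0) + (if a then 1 else 0) * (if b then 1 else 0)) =
      if xor a b then 1 else 0 := by
  cases a <;> cases b <;> decide

/-- Ring-game helper `tPoly_apply` (lens-2 law package; see the module docstring). -/
theorem tPoly_apply (j : Fin N) (x : Fin N → Bool) :
    tPoly j x = if tGuess x j then 1 else 0 := by
  simp only [tPoly, Pi.add_apply, Pi.mul_apply, mono_singleton_apply, tGuess]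
  exact xor_indicator_bool (x j) (x (nxt j))

/-- the selector `[f = 1]` as a polynomial: `1 - (f - 1)²`. -/
def selP (f : CubeFn (ZMod 3) N) : CubeFn (ZMod 3) N := 1 - (f - 1) * (f - 1)

/-- Ring-game helper `selP_mem` (lens-2 law package; see the module docstring). -/
theorem selP_mem {D : ℕ} {f : CubeFn (ZMod 3) N} (hf : f ∈ lowDeg (ZMod 3) N D) :
    selP f ∈ lowDeg (ZMod 3) N (D + D) := by
  unfold selP
  have h1 : f - 1 ∈ lowDeg (ZMod 3) N D := Submodule.sub_mem _ hf (one_mem_lowDeg D)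
  exact Submodule.sub_mem _ (one_mem_lowDeg _) (mul_mem_lowDeg_add h1 h1)

/-- Ring-game helper `selP_apply` (lens-2 law package; see the module docstring). -/
theorem selP_apply (f : CubeFn (ZMod 3) N) (x : Fin N → Bool) :
    selP f x = if f x = 1 then 1 else 0 := by
  simp only [selP, Pi.sub_apply, Pi.mul_apply, Pi.one_apply]
  generalize f x = v
  revert v; decide

/-- XOR of two `0/1`-valued polynomials: `a + b + ab (mod 3)`. -/
def xorP (a b : CubeFn (ZMod 3) N) : CubeFn (ZMod 3) N := a + b + a * b

/-- Ring-game helper `xorP_mem` (lens-2 law package; see the module docstring). -/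
theorem xorP_mem {D E : ℕ} {a b : CubeFn (ZMod 3) N} (ha : a ∈ lowDeg (ZMod 3) N D)
    (hb : b ∈ lowDeg (ZMod 3) N E) : xorP a b ∈ lowDeg (ZMod 3) N (D + E) :=
  Submodule.add_mem _ (Submodule.add_mem _ (lowDeg_mono (by omega) ha) (lowDeg_mono (by omega) hb))
    (mul_mem_lowDeg_add ha hb)

/-- Ring-game helper `xorP_apply_bool` (lens-2 law package; see the module docstring). -/
theorem xorP_apply_bool (a b : CubeFn (ZMod 3) N) (x : Fin N → Bool) (p q : Bool)
    (ha : a x = if p then 1 else 0) (hb : b x = if q then 1 else 0) :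
    xorP a b x = if xor p q then 1 else 0 := by
  simp only [xorP, Pi.add_apply, Pi.mul_apply, ha, hb]
  cases p <;> cases q <;> decide

/-- **the pointer strategy steered by `f`** as a tuple of `𝔽₃` polynomials: position `0` plays
`t_0 ⊕ [f = 1]`, position `1` plays `t_1 ⊕ ¬[f = 1]`, every other position the canonical guess. -/
def ptrStrat (f : CubeFn (ZMod 3) N) (i : Fin N) : CubeFn (ZMod 3) N :=
  if i.val = 0 then xorP (tPoly i) (selP f)
  else if i.val = 1 then xorP (tPoly i) (1 - selP f)
  else tPoly i

/-- Ring-game helper `ptrStrat_mem` (lens-2 law package; see the module docstring). -/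
theorem ptrStrat_mem {D : ℕ} {f : CubeFn (ZMod 3) N} (hf : f ∈ lowDeg (ZMod 3) N D) (i : Fin N) :
    ptrStrat f i ∈ lowDeg (ZMod 3) N (2 + (D + D)) := by
  unfold ptrStrat
  split_ifs
  · exact xorP_mem (tPoly_mem i) (selP_mem hf)
  · exact xorP_mem (tPoly_mem i) (Submodule.sub_mem _ (one_mem_lowDeg _) (selP_mem hf))
  · exact lowDeg_mono (by omega) (tPoly_mem i)

/-- the Boolean output of the pointer strategy. -/
theorem ptrStrat_out (f : CubeFn (ZMod 3) N) (i : Fin N) (x : Fin N → Bool) :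
    decide (ptrStrat f i x = 1) =
      xor (tGuess x i) (if i.val = 0 then decide (f x = 1) else if i.val = 1 then !decide (f x = 1) else false) := by
  have h1 : (1 - selP f) x = if !(decide (f x = 1)) then 1 else 0 := by
    simp only [Pi.sub_apply, Pi.one_apply, selP_apply]
    by_cases h : f x = 1 <;> simp [h]
  have h0 : selP f x = if decide (f x = 1) then 1 else 0 := by
    rw [selP_apply]; by_cases h : f x = 1 <;> simp [h]
  unfold ptrStrat
  split_ifs with hi0 hi1
  · rw [xorP_apply_bool _ _ x _ _ (tPoly_apply i x) h0]
    cases xor (tGuess x i) (decide (f x = 1)) <;> decide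
  · rw [xorP_apply_bool _ _ x _ _ (tPoly_apply i x) h1]
    cases xor (tGuess x i) (!decide (f x = 1)) <;> decide
  · rw [tPoly_apply]
    cases tGuess x i <;> decide

/-- `W_1 ≤ 1`. -/
theorem Wk_one_le (x : Fin N → Bool) : Wk x 1 ≤ 1 := by
  unfold Wk
  rcases Nat.eq_zero_or_pos N with hN | hN
  · subst hN
    simp
  · calc (univ.filter fun i : Fin N => i.val < 1 ∧ uCoord x i = true).card
        ≤ ({(⟨0, hN⟩ : Fin N)} : Finset (Fin N)).card := by
          refine card_le_card fun i hi => ?_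
          rw [mem_filter] at hi
          rw [mem_singleton, Fin.ext_iff]
          exact Nat.lt_one_iff.mp hi.2.1
      _ = 1 := card_singleton _

/-- the two root positions are never both outside the kernel support: `g_0 ∨ g_1`. -/
theorem gCond_zero_or_one (x : Fin N → Bool) : gCond x 0 ∨ gCond x 1 := by
  unfold gCond
  have h1 := Wk_one_le x
  rw [Wk_zero]
  by_contra h
  push Not at h
  omega

/-- **LAW (pointer dictionary)**: on the odd class the pointer strategy steered by `f` satisfies the ring relation
iff the {0,1}-pointer wins (`traceForm`). -/
theorem rel_ptrStrat_iff (hN : 3 ≤ N) (f : CubeFn (ZMod 3) N) (x : Fin N → Bool) (hx : OddZeros x) :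
    Rel x (fun i => decide (ptrStrat f i x = 1)) ↔ BinPtrWin f x := by
  rw [traceForm hN x hx]
  simp only [ptrStrat_out]
  -- the filtered set is `{0 | f x = 1 ∧ g_0} ∪ {1 | f x ≠ 1 ∧ g_1}`
  have h0N : 0 < N := by omega
  have h1N : 1 < N := by omega
  set S := univ.filter fun k : Fin N =>
      xor (xor (tGuess x k) (if k.val = 0 then decide (f x = 1) else if k.val = 1 then !decide (f x = 1) else false))
          (tGuess x k) = true ∧
        (k.val + N + Wk x k.val + Wk x (N - 1)) % 3 ≠ 2 with hS
  have hmem : ∀ k : Fin N, k ∈ S ↔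
      (k.val = 0 ∧ f x = 1 ∧ gCond x 0) ∨ (k.val = 1 ∧ f x ≠ 1 ∧ gCond x 1) := by
    intro k
    rw [hS, mem_filter]
    simp only [mem_univ, true_and, gCond]
    by_cases hk0 : k.val = 0
    · simp only [hk0, if_true]
      cases tGuess x k <;> by_cases hf : f x = 1 <;> simp [hf]
    · by_cases hk1 : k.val = 1
      · simp only [hk1, if_true]
        cases tGuess x k <;> by_cases hf : f x = 1 <;> simp [hf]
      · simp only [hk0, hk1, if_false]
        cases tGuess x k <;> simp
  by_cases hf : f x = 1
  · -- pointer at 0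
    have hBin : BinPtrWin f x ↔ gCond x 0 := by
      unfold BinPtrWin; constructor
      · intro h; exact h.1 hf
      · intro h; exact ⟨fun _ => h, fun h' => absurd hf h'⟩
    rw [hBin]
    by_cases hg : gCond x 0
    · have hS1 : S = {⟨0, h0N⟩} := by
        ext k
        rw [hmem, mem_singleton, Fin.ext_iff]
        constructor
        · rintro (⟨hk, -, -⟩ | ⟨-, hne, -⟩)
          · exact hk
          · exact absurd hf hne
        · intro hk; exact Or.inl ⟨hk, hf, hg⟩
      rw [hS1, card_singleton]
      simp [hg]
    · have hS0 : S = ∅ := by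
        ext k
        rw [hmem]
        simp only [Finset.notMem_empty, iff_false, not_or]
        exact ⟨fun h => hg h.2.2, fun h => h.2.1 hf⟩
      rw [hS0, card_empty]
      simp [hg]
  · have hBin : BinPtrWin f x ↔ gCond x 1 := by
      unfold BinPtrWin; constructor
      · intro h; exact h.2 hf
      · intro h; exact ⟨fun h' => absurd h' hf, fun _ => h⟩
    rw [hBin]
    by_cases hg : gCond x 1
    · have hS1 : S = {⟨1, h1N⟩} := by
        ext k
        rw [hmem, mem_singleton, Fin.ext_iff]
        constructor
        · rintro (⟨-, h1, -⟩ | ⟨hk, -, -⟩)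
          · exact absurd h1 hf
          · exact hk
        · intro hk; exact Or.inr ⟨hk, hf, hg⟩
      rw [hS1, card_singleton]
      simp [hg]
    · have hS0 : S = ∅ := by
        ext k
        rw [hmem]
        simp only [Finset.notMem_empty, iff_false, not_or]
        exact ⟨fun h => hf h.2.1, fun h => hg h.2.2⟩
      rw [hS0, card_empty]
      simp [hg]

end Strategy
end HolonomyDial

end Summit.QuantumAdvantage.QuantumAdvantage.Theorems
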